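import Mathlib
import Summits.ValiantsHypothesis.ValiantsHypothesis.Theorems.GrenetZeonTwoDimCoefficientsScalingRankOneCoupling

/-!
# Crux `GrenetZeon.TwoDimCoefficients` (stmt-ValiantsHypothesis-8062) / rung `DualUnipotentThreeHalves` (stmt-24318):
# scaling-closure — LOW-RANK COUPLINGS UNDER PIECEWISE HIGH CONSTRAINTS cost `O(r·m)` at any nil-index

Additive extension of ✓ `rank_hess0_trace_pow_vecMulVec_le` (p838993: a rank-one numerator `u vᵀ` with the high constraints
costs `≤ 2(m+1)` whatever the nil-index of `N`).  A numerator of rank `r` factored as `M♭ = U·V` (`U` a constant `m × r`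
matrix, `V` an `r × m` matrix of linear forms) is the sum of the `r` rank-one numerators `u_i v_iᵀ` (columns of `U`, rows of
`V`); if EACH piece satisfies the high constraints `v_iᵀ N^k u_i = 0` (`k ≥ n`) — equivalently the DIAGONAL of `V·N^k·U`
vanishes, in particular if the coupling vanishes at the matrix level, `V·N^k·U = 0` for `k ≥ n` — then Hessian ranks add:

* ★ `rank_hess0_trace_pow_constMul_le` — `rank Hess tr(N^{n−1}·U V)(z) ≤ r·2(m+1)` at every point `z`, any nil-index;
* `diag_eq_zero_of_mul_pow_mul_eq_zero` — the matrix-level constraints imply the piecewise ones;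
* ★ `sq_sub_mul_le_of_levelCut_lowRankCut` — ledger form: level-cut `N` with index-`n` classes and a cut part `U·V` with
  piecewise high constraints ⟹ `(n² − 2r(m+1))·n ≤ 2·Σ_p s_p²`; so the 3/2 rung survives couplings of rank `r = o(n²/m)`.

CAVEAT (memo TWENTIETH-HAND.md §2, §4): the representation only supplies the TRACE constraint `tr(V·N^k·U) = 0`; the piecewise /
matrix-level constraints are a genuine extra hypothesis for `r ≥ 2` (for `r = 1` they coincide).  The full-rank constrained
cut term (P3′) stays open.

HONEST FRAMING: a conditional-free but hypothesis-heavy class; no stub is closed: `DualUnipotentBound`, crux 8062, the 24318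
decl and `VP ≠ VNP` remain open.

References: T. Mignon, N. Ressayre, Int. Math. Res. Not. 2004:79, Thm. 1.1 (via the tree); folklore.
-/

-- single-conjunct layout `Summits/ValiantsHypothesis/ValiantsHypothesis`: the duplicated namespace
-- component is mandated by the tree.
set_option linter.dupNamespace false
set_option autoImplicit false

noncomputable section

namespace Summit.ValiantsHypothesis.ValiantsHypothesis.Theorems.GrenetZeonTwoDimCoefficients.ScalingClosure

open MvPolynomial Matrix
open Literature.Computability.AlgebraicComplexity
open Summit.ValiantsHypothesis.ValiantsHypothesis.Cruxes.TwoDimCoefficients.DimTwoCases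
open Summit.ValiantsHypothesis.ValiantsHypothesis.Theorems.GrenetZeon.SlowCore

section LowRankCoupling

variable {n m r : ℕ}

/-- A product `U·V` is the sum of the rank-one matrices (column `i` of `U`)·(row `i` of `V`). [folklore] -/
theorem map_C_mul_eq_sum_vecMulVec (U : Matrix (Fin m) (Fin r) ℂ) (V : Matrix (Fin r) (Fin m) (MvPolynomial (Fin n × Fin n) ℂ)) :
    U.map (MvPolynomial.C : ℂ →+* MvPolynomial (Fin n × Fin n) ℂ) * V = ∑ i : Fin r, vecMulVec (fun a => MvPolynomial.C (U a i)) (V i) := by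
  refine Matrix.ext fun a b => ?_
  rw [Matrix.mul_apply, Matrix.sum_apply]
  refine Finset.sum_congr rfl fun i _ => ?_
  rw [vecMulVec_apply, Matrix.map_apply]

/-- The trace against `U·V` splits into the rank-one traces. [folklore] -/
theorem trace_pow_mul_constMul_eq_sum (N : AffMat n m) (U : Matrix (Fin m) (Fin r) ℂ)
    (V : Matrix (Fin r) (Fin m) (MvPolynomial (Fin n × Fin n) ℂ)) (k : ℕ) :
    (N ^ k * (U.map (MvPolynomial.C : ℂ →+* MvPolynomial (Fin n × Fin n) ℂ) * V)).trace =
      ∑ i : Fin r, (N ^ k * vecMulVec (fun a => MvPolynomial.C (U a i)) (V i)).trace := by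
  rw [map_C_mul_eq_sum_vecMulVec, Matrix.mul_sum, Matrix.trace_sum]

/-- The rank-one trace is a diagonal entry of `V·N^k·U`. [folklore] -/
theorem trace_pow_mul_vecMulVec_eq_diag (N : AffMat n m) (U : Matrix (Fin m) (Fin r) ℂ)
    (V : Matrix (Fin r) (Fin m) (MvPolynomial (Fin n × Fin n) ℂ)) (k : ℕ) (i : Fin r) :
    (N ^ k * vecMulVec (fun a => MvPolynomial.C (U a i)) (V i)).trace = (V * N ^ k * U.map (MvPolynomial.C : ℂ →+* MvPolynomial (Fin n × Fin n) ℂ)) i i := by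
  rw [Matrix.mul_assoc]
  simp only [Matrix.trace, Matrix.diag_apply, Matrix.mul_apply, vecMulVec_apply, Matrix.map_apply, Finset.mul_sum]
  refine Finset.sum_congr rfl fun a _ => Finset.sum_congr rfl fun b _ => ?_
  ring

/-- **Matrix-level high constraints imply the piecewise ones.** [folklore] -/
theorem trace_pow_mul_vecMulVec_eq_zero_of_mul_pow_mul_eq_zero (N : AffMat n m) (U : Matrix (Fin m) (Fin r) ℂ)
    (V : Matrix (Fin r) (Fin m) (MvPolynomial (Fin n × Fin n) ℂ)) (k : ℕ)
    (hzero : V * N ^ k * U.map (MvPolynomial.C : ℂ →+* MvPolynomial (Fin n × Fin n) ℂ) = 0) (i : Fin r) :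
    (N ^ k * vecMulVec (fun a => MvPolynomial.C (U a i)) (V i)).trace = 0 := by
  rw [trace_pow_mul_vecMulVec_eq_diag, hzero, Matrix.zero_apply]

/-- ★ **Low-rank numerators under piecewise high constraints cost `O(r·m)`, whatever the nil-index.**  `N` linear with
`N^m = 0`; `U` a constant `m × r` matrix, `V` an `r × m` matrix of linear forms; if every rank-one piece satisfies the high
constraints (`(V·N^k·U)_{ii} = 0` for `k ≥ n`), then `rank Hess tr(N^{n−1}·U V)(z) ≤ r·(2(m+1))` at every point `z`
(`n ≥ 2`). [cite: MignonRessayre2004, Thm. 1.1 — via the tree; folklore] -/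
theorem rank_hess0_trace_pow_constMul_le (hn : 2 ≤ n) (N : AffMat n m) (hN : ∀ i j, (N i j).IsHomogeneous 1)
    (hNm : N ^ m = 0) (U : Matrix (Fin m) (Fin r) ℂ) (V : Matrix (Fin r) (Fin m) (MvPolynomial (Fin n × Fin n) ℂ))
    (hV : ∀ i j, (V i j).IsHomogeneous 1)
    (hhigh : ∀ k, n ≤ k → ∀ i : Fin r, (V * N ^ k * U.map (MvPolynomial.C : ℂ →+* MvPolynomial (Fin n × Fin n) ℂ)) i i = 0)
    (z : Fin n × Fin n → ℂ) :
    (hess0 (transl z ((N ^ (n - 1) * (U.map (MvPolynomial.C : ℂ →+* MvPolynomial (Fin n × Fin n) ℂ) * V)).trace))).rank ≤ r * (2 * (m + 1)) := by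
  classical
  rw [trace_pow_mul_constMul_eq_sum, map_sum, map_sum]
  refine (rank_sum_le _ _).trans ?_
  calc ∑ i : Fin r, (hess0 (transl z ((N ^ (n - 1) * vecMulVec (fun a => MvPolynomial.C (U a i)) (V i)).trace))).rank
      ≤ ∑ _i : Fin r, 2 * (m + 1) := Finset.sum_le_sum fun i _ =>
        rank_hess0_trace_pow_vecMulVec_le hn N hN hNm (fun a => U a i) (V i) (fun j => hV i j)
          (fun k hk => by rw [trace_pow_mul_vecMulVec_eq_diag]; exact hhigh k hk i) z
    _ = r * (2 * (m + 1)) := by rw [Finset.sum_const, Finset.card_univ, Fintype.card_fin, smul_eq_mul]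

/-- ★ **Low-rank back-coupling under piecewise high constraints (ledger form).**  Normal form `per_n = tr(N^{n−1}M)` with
`N, M` linear, `N^m = 0`, `N` level-cut for `lvl` with index-`n` classes, cut part `M^cut = U·V` of rank `r` (`U` constant,
`V` linear) whose pieces satisfy the high constraints.  Then `(n² − 2r(m+1))·n ≤ 2·Σ_p s_p²`.
[cite: MignonRessayre2004, Thm. 1.1 — via the tree; folklore] -/
theorem sq_sub_mul_le_of_levelCut_lowRankCut (hn : 2 ≤ n) (N M : AffMat n m)
    (hN : ∀ i j, (N i j).IsHomogeneous 1) (hM : ∀ i j, (M i j).IsHomogeneous 1) (hNm : N ^ m = 0)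
    (hper : perPoly (Fin n) ℂ = (N ^ (n - 1) * M).trace)
    (lvl : Fin m → ℕ) (hcut : ∀ a b, lvl a < lvl b → N a b = 0)
    (s : ℕ → ℕ) (e : ∀ p : ℕ, {i : Fin m // lvl i = p} ≃ Fin (s p))
    (hindex : ∀ p ∈ Finset.univ.image lvl, (classPencil N (e p)) ^ n = 0)
    (U : Matrix (Fin m) (Fin r) ℂ) (V : Matrix (Fin r) (Fin m) (MvPolynomial (Fin n × Fin n) ℂ))
    (hV : ∀ i j, (V i j).IsHomogeneous 1)
    (hhigh : ∀ k, n ≤ k → ∀ i : Fin r, (V * N ^ k * U.map (MvPolynomial.C : ℂ →+* MvPolynomial (Fin n × Fin n) ℂ)) i i = 0)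
    (hMcut : Matrix.of (fun i j : Fin m => if lvl i < lvl j then M i j else 0) = U.map (MvPolynomial.C : ℂ →+* MvPolynomial (Fin n × Fin n) ℂ) * V) :
    (n ^ 2 - 2 * r * (m + 1)) * n ≤ 2 * ∑ p ∈ Finset.univ.image lvl, s p ^ 2 := by
  classical
  have h := sq_sub_rank_mul_le_of_levelCut hn N M hN hM hper lvl hcut s e (Finset.univ.image lvl)
    (Finset.Subset.refl _) hindex
  have hempty : (Finset.univ.image lvl).filter (fun p => p ∉ Finset.univ.image lvl) = ∅ := by
    ext p
    simp only [Finset.mem_filter, Finset.notMem_empty, iff_false, not_and, not_not]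
    exact fun hp => hp
  rw [hempty, Finset.sum_empty, zero_add, hMcut] at h
  have hrank := rank_hess0_trace_pow_constMul_le hn N hN hNm U V hV hhigh
    (fun w : Fin n × Fin n => if w.1 = (1 : Equiv.Perm (Fin n)) w.2 then (1 : ℂ) else 0)
  have hr : 2 * r * (m + 1) = r * (2 * (m + 1)) := by ring
  rw [hr]
  exact (Nat.mul_le_mul_right _ (by omega)).trans h

end LowRankCoupling

end Summit.ValiantsHypothesis.ValiantsHypothesis.Theorems.GrenetZeonTwoDimCoefficients.ScalingClosure

end
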